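import Summits.ValiantsHypothesis.ValiantsHypothesis.Theorems.DepthWindowHomNewtonRefs
import HarnessLib

/-!
# Route `DepthWindow`, g8 — Newton gadget (3/4): the value of gate `F` and the depth entries

The product of the translated operands factors as `Z · γ · Π_N (1 + a_u)` with `a_u` of constant
coefficient `0`; by the truncated Newton identity (`DepthWindowNewtonTrunc.truncNewton`) gate `F`
has the value of the product modulo weight `> d` (`exists_cc_gateF`).  Then the depth entries:
layer `B ≤ 2δ₀`, `W, P ≤ 2δ₀ + 1`, `M, F ≤ 2δ₀ + 2 = 2 ·` (old entry of the product gate).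

[cite: LimayeSrinivasanTavenas2025, Lemma 11, Lemma 19, Lemma 20] [cite: Strassen1973, §3]
[cite: Burgisser2000, Def. 2.1]
-/

-- layout Summits/ValiantsHypothesis/ValiantsHypothesis forces the duplicated namespace component
set_option linter.dupNamespace false

namespace Summit.ValiantsHypothesis.ValiantsHypothesis.Theorems.DepthWindow

open MvPolynomial Literature.Computability.AlgebraicComplexity ArithCircuit
open Literature.Computability.AlgebraicComplexity.DepthReduction

section Values

variable {k : Type*} [Field k] {τ : Type*}
variable (i : ℕ) (pos : ℕ → ℕ) (c : ℕ → k) (us : List (Operand k τ)) (d : ℕ)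
variable {Ψ₀ : List (Gate k τ)}

/-- Pointwise factorisation of a translated operand value: Z-part · constant · `(1 + A-value)`. -/
theorem top_eval_factor (V₀ : List (MvPolynomial τ k)) {u : Operand k τ} (hu : u ∈ us) :
    (top i pos u).eval V₀ =
      (if isZb i c u then (top i pos u).eval V₀ else 1) *
        (C (constPart i c u) * (1 + aval i pos c us V₀ u)) := by
  cases u with
  | var t => simp [isZb, constPart, aval]
  | const a => simp [isZb, constPart, aval, top, Operand.eval]
  | gate j =>
      by_cases h : j < i ∧ c j ≠ 0
      · have hz : isZb i c (Operand.gate j : Operand k τ) = false := by simp [isZb, h]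
        have hcp : constPart i c (Operand.gate j : Operand k τ) = c j := by simp [constPart, h]
        have hav : aval i pos c us V₀ (Operand.gate j) = (gateB i pos c us j).eval V₀ := by
          simp [aval, h]
        have hB : gateB i pos c us j = Gate.sum [((c j)⁻¹, .gate (pos j)), (-1, .const 1)] := by
          unfold gateB; rw [if_pos ⟨h.1, h.2, hu⟩]
        have ht : top i pos (Operand.gate j : Operand k τ) = Operand.gate (pos j) := by
          simp only [top]; rw [if_pos h.1]
        rw [hz, hcp, hav, hB, ht]
        simp only [Bool.false_eq_true, if_false, one_mul, eval_sum, List.map_cons, List.map_nil,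
          List.sum_cons, List.sum_nil, add_zero, Operand.eval_gate]
        rw [show (Operand.const (1 : k) : Operand k τ).eval V₀ = C 1 from rfl, smul_eq_C_mul,
          smul_eq_C_mul, map_one, mul_one, map_neg, map_one,
          show (1 : MvPolynomial τ k) + (C (c j)⁻¹ * V₀.getD (pos j) 0 + -1) =
            C (c j)⁻¹ * V₀.getD (pos j) 0 by ring,
          ← mul_assoc, ← map_mul, mul_inv_cancel₀ h.2, map_one, one_mul]
      · have hz : isZb i c (Operand.gate j : Operand k τ) = true := by simp [isZb, h]
        have hcp : constPart i c (Operand.gate j : Operand k τ) = 1 := by simp [constPart, h]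
        have hav : aval i pos c us V₀ (Operand.gate j) = 0 := by simp [aval, h]
        rw [hz, hcp, hav]
        simp

/-- **Factorisation of the translated product**: Z-part · `C γ` · `Π_u (1 + aval u)`. -/
theorem prod_map_top_eval (V₀ : List (MvPolynomial τ k)) :
    (us.map fun u => (top i pos u).eval V₀).prod =
      ((zops i pos c us).map fun u => u.eval V₀).prod *
        (C (us.map (constPart i c)).prod * (us.map fun u => 1 + aval i pos c us V₀ u).prod) := by
  rw [show (us.map fun u => (top i pos u).eval V₀) =
      us.map fun u => (if isZb i c u then (top i pos u).eval V₀ else 1) *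
        (C (constPart i c u) * (1 + aval i pos c us V₀ u)) from
      List.map_congr_left fun u hu => top_eval_factor i pos c us V₀ hu,
    List.prod_map_mul, List.prod_map_mul, prod_map_ite_eq_prod_filter, zops, List.map_map,
    map_list_prod, List.map_map]
  rfl

/-- A-values vanish below weight `1` (their constant coefficient is `0`). -/
theorem below_one_aval (w : τ → ℕ) (hw : ∀ t, 1 ≤ w t) {V₀ : List (MvPolynomial τ k)}
    (hc : ∀ j < i, coeff 0 (V₀.getD (pos j) 0) = c j) :
    ∀ u : Operand k τ, below w 1 (aval i pos c us V₀ u) = 0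
  | .var _ => by simp [aval]
  | .const _ => by simp [aval]
  | .gate j => by
      classical
      simp only [aval]
      by_cases h : j < i ∧ c j ≠ 0
      · rw [if_pos h]
        unfold gateB
        by_cases h' : j < i ∧ c j ≠ 0 ∧ Operand.gate j ∈ us
        · rw [if_pos h']
          refine below_one_of_coeff_zero w hw ?_
          simp only [eval_sum, List.map_cons, List.map_nil, List.sum_cons, List.sum_nil, add_zero,
            Operand.eval_gate, coeff_add, coeff_smul, hc j h.1, smul_eq_mul,
            inv_mul_cancel₀ h.2]
          rw [show (Operand.const (1 : k) : Operand k τ).eval V₀ = C 1 from rfl, coeff_C]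
          simp
        · rw [if_neg h']
          simp [eval_sum]
      · rw [if_neg h, map_zero]

/-- The Z-part vanishes below the number of Z-operands. -/
theorem below_zops_prod (w : τ → ℕ) (hw : ∀ t, 1 ≤ w t) {V₀ : List (MvPolynomial τ k)}
    (hc : ∀ j < i, coeff 0 (V₀.getD (pos j) 0) = c j) :
    below w (zops i pos c us).length (((zops i pos c us).map fun u => u.eval V₀).prod) = 0 := by
  rw [← List.length_map (f := fun u => u.eval V₀)]
  refine below_list_prod_eq_zero w _ fun p hp => ?_
  simp only [zops, List.map_map, List.mem_map, List.mem_filter, Function.comp_apply] at hp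
  obtain ⟨u, ⟨_, hz⟩, rfl⟩ := hp
  cases u with
  | var t => exact below_one_of_coeff_zero w hw (coeff_zero_X t)
  | const a => simp [isZb] at hz
  | gate j =>
      simp only [isZb, Bool.not_eq_true', decide_eq_false_iff_not, not_and, not_not] at hz
      simp only [top]
      by_cases hj : j < i
      · rw [if_pos hj]
        exact below_one_of_coeff_zero w hw (by rw [Operand.eval_gate, hc j hj, hz hj])
      · rw [if_neg hj, show (Operand.const (0 : k) : Operand k τ).eval V₀ = C 0 from rfl, map_zero,
          map_zero]

variable [Algebra ℚ k] (cc : (kk : ℕ) → kk.Partition → ℚ)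

/-- **Gate `F` value** (at most `d` Z-operands): `Z · C γ · Σ_{k' ≤ d} Σ_μ c_{k',μ} Π_{j∈μ} p_j`. -/
theorem eval_gateF (hpos : ∀ j < i, pos j < Ψ₀.length) (hz : (zops i pos c us).length ≤ d) :
    (gateF i pos c us d Ψ₀.length cc).eval (gateValues (psi4 i pos c us d Ψ₀)) =
      ((zops i pos c us).map fun u => u.eval (gateValues Ψ₀)).prod *
        (C (us.map (constPart i c)).prod *
          ∑ kk ∈ Finset.range (d + 1), ∑ μ : kk.Partition,
            cc kk μ • (μ.parts.map fun j =>
              (us.map fun u => aval i pos c us (gateValues Ψ₀) u ^ j).sum).prod) := by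
  have hzk : zkeep i pos c us d = zops i pos c us := by unfold zkeep; rw [if_pos hz]
  unfold gateF
  rw [if_pos hz, eval_sum, List.map_map,
    map_range_eq_map (pairs d) dfltPair _
      (fun pr : (Σ kk : ℕ, kk.Partition) =>
        ((us.map (constPart i c)).prod * algebraMap ℚ k (cc pr.1 pr.2)) •
          (((zops i pos c us).map fun u => u.eval (gateValues Ψ₀)).prod *
            (pr.2.parts.toList.map fun j =>
              (us.map fun u => aval i pos c us (gateValues Ψ₀) u ^ j).sum).prod))
      (fun r hr => by
        simp only [Function.comp_apply, Operand.eval_gate, coefF]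
        rw [getD_psi4 i pos c us d hpos hr, hzk]),
    sum_map_pairs]
  simp only [Finset.mul_sum]
  refine Finset.sum_congr rfl fun kk _ => Finset.sum_congr rfl fun μ _ => ?_
  rw [Multiset.prod_map_toList, ← algebraMap_smul k (cc kk μ), smul_eq_C_mul, smul_eq_C_mul,
    map_mul]
  ring

/-- **The gadget computes the product modulo weight `> d`.**  For suitable rational coefficients
(those of the truncated Newton identity for this gate) the value of gate `F` agrees below weight
`d + 1` with the product of the translated operands. [cite: LimayeSrinivasanTavenas2025, Lemma 11] -/
theorem exists_cc_gateF (w : τ → ℕ) (hw : ∀ t, 1 ≤ w t) (hpos : ∀ j < i, pos j < Ψ₀.length)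
    (hc : ∀ j < i, coeff 0 ((gateValues Ψ₀).getD (pos j) 0) = c j) :
    ∃ cc : (kk : ℕ) → kk.Partition → ℚ,
      below w (d + 1) ((gateF i pos c us d Ψ₀.length cc).eval (gateValues (psi4 i pos c us d Ψ₀))) =
        below w (d + 1) ((us.map fun u => (top i pos u).eval (gateValues Ψ₀)).prod) := by
  by_cases hz : (zops i pos c us).length ≤ d
  · set A : Fin us.length → MvPolynomial τ k := fun l => aval i pos c us (gateValues Ψ₀) (us.get l)
      with hA
    obtain ⟨cc, hN⟩ := truncNewton w d A fun l => below_one_aval i pos c us w hw hc (us.get l)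
    refine ⟨cc, ?_⟩
    rw [eval_gateF i pos c us d cc hpos hz, prod_map_top_eval,
      prod_map_eq_prod_get us fun u => 1 + aval i pos c us (gateValues Ψ₀) u]
    simp_rw [sum_map_eq_sum_get us]
    exact below_mul_congr w rfl (below_mul_congr w rfl hN.symm)
  · refine ⟨fun _ _ => 0, ?_⟩
    unfold gateF
    rw [if_neg hz, prod_map_top_eval]
    simp only [eval_sum, List.map_nil, List.sum_nil, map_zero]
    exact (below_mul_eq_zero_right w
      (below_eq_zero_mono w (below_zops_prod i pos c us w hw hc) (by omega)) _).symm

end Values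

/-! ### Depth entries of the layers -/

section Depths

variable {k : Type*} [Field k] {τ : Type*}
variable (i : ℕ) (pos : ℕ → ℕ) (c : ℕ → k) (us : List (Operand k τ)) (d : ℕ)

omit [Field k] in
/-- Sum gates weigh `0`. -/
theorem prodWeight_sum (l : List (k × Operand k τ)) : prodWeight (Gate.sum l : Gate k τ) = 0 := rfl

omit [Field k] in
/-- Product gates weigh `1`. -/
theorem prodWeight_prod (l : List (Operand k τ)) : prodWeight (Gate.prod l : Gate k τ) = 1 := rfl

omit [Field k] in
/-- The depth entry of a product gate: `1 +` the maximal operand depth. -/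
theorem depthAgainst_prod (ds : List ℕ) (l : List (Operand k τ)) :
    Gate.depthAgainst prodWeight ds (Gate.prod l) = 1 + (l.map (Operand.depthIn ds)).foldr max 0 := by
  unfold Gate.depthAgainst; rw [prodWeight_prod]; rfl

omit [Field k] in
/-- The depth entry of a sum gate: the maximal operand depth. -/
theorem depthAgainst_sum (ds : List ℕ) (l : List (k × Operand k τ)) :
    Gate.depthAgainst prodWeight ds (Gate.sum l) =
      ((l.map Prod.snd).map (Operand.depthIn ds)).foldr max 0 := by
  unfold Gate.depthAgainst; rw [prodWeight_sum, zero_add]; rfl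

/-- **Translated operands have at most twice the old depth** (given the positional invariant). -/
theorem depthIn_top_le {D₀ ds : List ℕ} (hdep : ∀ j < i, D₀.getD (pos j) 0 ≤ 2 * ds.getD j 0) :
    ∀ u : Operand k τ, (top i pos u).depthIn D₀ ≤ 2 * u.depthIn ds
  | .var _ => Nat.zero_le _
  | .const _ => Nat.zero_le _
  | .gate j => by
      simp only [top]
      split_ifs with h
      · exact hdep j h
      · exact Nat.zero_le _

/-- A translated sum gate has at most twice the old depth entry. -/
theorem depthAgainst_sum_top_le {D₀ ds : List ℕ}
    (hdep : ∀ j < i, D₀.getD (pos j) 0 ≤ 2 * ds.getD j 0) (args : List (k × Operand k τ)) :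
    Gate.depthAgainst prodWeight D₀ (Gate.sum (args.map fun a => (a.1, top i pos a.2))) ≤
      2 * Gate.depthAgainst prodWeight ds (Gate.sum args) := by
  rw [depthAgainst_sum, depthAgainst_sum]
  refine foldr_max_le fun x hx => ?_
  simp only [List.map_map, List.mem_map, Function.comp_apply] at hx
  obtain ⟨a, ha, rfl⟩ := hx
  have h1 := depthIn_top_le i pos hdep a.2
  have h2 : a.2.depthIn ds ≤ ((args.map Prod.snd).map (Operand.depthIn ds)).foldr max 0 :=
    le_foldr_max_of_mem (by
      simp only [List.map_map, List.mem_map, Function.comp_apply]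
      exact ⟨a, ha, rfl⟩)
  omega

/-- Layer `B` entries are `≤ 2 δ₀` (`δ₀` = maximal old operand depth of the product gate). -/
theorem depthAgainst_gateB_le {D₀ ds : List ℕ} (hdep : ∀ j < i, D₀.getD (pos j) 0 ≤ 2 * ds.getD j 0)
    (j : ℕ) : Gate.depthAgainst prodWeight D₀ (gateB i pos c us j) ≤
      2 * (us.map (Operand.depthIn ds)).foldr max 0 := by
  unfold gateB
  split_ifs with h
  · rw [depthAgainst_sum]
    refine foldr_max_le fun x hx => ?_
    simp only [List.map_cons, List.map_nil, List.mem_cons, List.not_mem_nil, or_false] at hx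
    rcases hx with rfl | rfl
    · refine (hdep j h.1).trans (Nat.mul_le_mul_left 2 ?_)
      exact le_foldr_max_of_mem (List.mem_map.mpr ⟨Operand.gate j, h.2.2, rfl⟩)
    · exact Nat.zero_le _
  · rw [depthAgainst_sum]; simp

omit [Field k] in
/-- Layer `W` entries are `≤ M + 1` when layer `B` entries are `≤ M`. -/
theorem depthAgainst_layerW_le {D₀ E : List ℕ} {L M : ℕ} (hL : D₀.length = L)
    (hE : ∀ x ∈ E, x ≤ M) :
    ∀ G ∈ (layerW i d L : List (Gate k τ)), Gate.depthAgainst prodWeight (D₀ ++ E) G ≤ M + 1 := by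
  intro G hG
  simp only [layerW, List.mem_map, List.mem_range] at hG
  obtain ⟨r, _, rfl⟩ := hG
  rw [depthAgainst_prod, Nat.add_comm]
  refine Nat.add_le_add_right (foldr_max_le fun x hx => ?_) 1
  rw [List.map_replicate] at hx
  obtain rfl := List.eq_of_mem_replicate hx
  show (D₀ ++ E).getD (L + r / (d + 1)) 0 ≤ M
  rw [← hL, getD_append_length_add]
  exact getD_le_of_forall_le hE _

/-- Layer `P` entries are `≤ M + 1` when layer `W` entries are. -/
theorem depthAgainst_layerP_le {D₁ E : List ℕ} {L M : ℕ} (hL : D₁.length = L + i)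
    (hE : ∀ x ∈ E, x ≤ M + 1) :
    ∀ G ∈ layerP i c us d L, Gate.depthAgainst prodWeight (D₁ ++ E) G ≤ M + 1 := by
  intro G hG
  simp only [layerP, List.mem_map, List.mem_range] at hG
  obtain ⟨jj, _, rfl⟩ := hG
  rw [depthAgainst_sum]
  refine foldr_max_le fun x hx => ?_
  simp only [List.map_map, List.mem_map, Function.comp_apply] at hx
  obtain ⟨u, _, rfl⟩ := hx
  cases u with
  | var t => exact Nat.zero_le _
  | const a => exact Nat.zero_le _
  | gate j =>
      simp only [argP]
      split_ifs with h
      · show (D₁ ++ E).getD (L + i + ((d + 1) * j + jj)) 0 ≤ M + 1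
        rw [← hL, getD_append_length_add]
        exact getD_le_of_forall_le hE _
      · exact Nat.zero_le _

/-- Kept Z-operands have depth `≤ 2 δ₀` against the prefix. -/
theorem depthIn_zkeep_le {D₀ ds : List ℕ} (hdep : ∀ j < i, D₀.getD (pos j) 0 ≤ 2 * ds.getD j 0)
    {u : Operand k τ} (hu : u ∈ zkeep i pos c us d) :
    u.depthIn D₀ ≤ 2 * (us.map (Operand.depthIn ds)).foldr max 0 := by
  have hu' := mem_zops_of_mem_zkeep i pos c us d hu
  simp only [zops, List.mem_map, List.mem_filter] at hu'
  obtain ⟨v, ⟨hv, _⟩, rfl⟩ := hu'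
  exact (depthIn_top_le i pos hdep v).trans
    (Nat.mul_le_mul_left 2 (le_foldr_max_of_mem (List.mem_map.mpr ⟨v, hv, rfl⟩)))

/-- Layer `M` entries are `≤ M + 2` when Z-operands are `≤ M` deep and layer `P` entries `≤ M + 1`. -/
theorem depthAgainst_layerM_le {D₀ E₁ E : List ℕ} {L M : ℕ} (hL0 : D₀.length = L)
    (hpos : ∀ j < i, pos j < L) (hZ : ∀ u ∈ zkeep i pos c us d, u.depthIn D₀ ≤ M)
    (hL : (D₀ ++ E₁).length = L + i + i * (d + 1)) (hE : ∀ x ∈ E, x ≤ M + 1) :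
    ∀ G ∈ layerM i pos c us d L, Gate.depthAgainst prodWeight (D₀ ++ E₁ ++ E) G ≤ M + 2 := by
  intro G hG
  simp only [layerM, List.mem_map] at hG
  obtain ⟨pr, _, rfl⟩ := hG
  rw [depthAgainst_prod, Nat.add_comm]
  refine Nat.add_le_add_right (foldr_max_le fun x hx => ?_) 1
  rw [List.map_append, List.mem_append, List.map_map] at hx
  rcases hx with hx | hx
  · rw [List.mem_map] at hx
    obtain ⟨u, hu, rfl⟩ := hx
    have hu' := mem_zops_of_mem_zkeep i pos c us d hu
    simp only [zops, List.mem_map] at hu'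
    obtain ⟨v, _, rfl⟩ := hu'
    rw [List.append_assoc, depthIn_append_of_refsBelow _ _ (hL0.symm ▸ top_refsBelow i pos hpos v)]
    exact (hZ _ hu).trans (by omega)
  · rw [List.mem_map] at hx
    obtain ⟨j, _, rfl⟩ := hx
    show (D₀ ++ E₁ ++ E).getD (L + i + i * (d + 1) + j) 0 ≤ M + 1
    rw [← hL, getD_append_length_add]
    exact getD_le_of_forall_le hE _

variable [Algebra ℚ k] (cc : (kk : ℕ) → kk.Partition → ℚ)

/-- Gate `F`'s entry is `≤ M + 2` when layer `M` entries are. -/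
theorem depthAgainst_gateF_le {D E : List ℕ} {L M : ℕ}
    (hL : D.length = L + i + i * (d + 1) + (d + 1)) (hE : ∀ x ∈ E, x ≤ M + 2) :
    Gate.depthAgainst prodWeight (D ++ E) (gateF i pos c us d L cc) ≤ M + 2 := by
  unfold gateF
  split_ifs
  · rw [depthAgainst_sum]
    refine foldr_max_le fun x hx => ?_
    simp only [List.map_map, List.mem_map, List.mem_range, Function.comp_apply] at hx
    obtain ⟨r, _, rfl⟩ := hx
    show (D ++ E).getD (L + i + i * (d + 1) + (d + 1) + r) 0 ≤ M + 2
    rw [← hL, getD_append_length_add]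
    exact getD_le_of_forall_le hE _
  · rw [depthAgainst_sum]; simp

end Depths

end Summit.ValiantsHypothesis.ValiantsHypothesis.Theorems.DepthWindow
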